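import Summits.BirchSwinnertonDyer.BirchSwinnertonDyer.Theses.LeadingTerm
import Summits.BirchSwinnertonDyer.BirchSwinnertonDyer.Theses.PadicCornerSqueeze

/-!
# Cross-route edge: `AnalyticRankLePadicOrder` ⟹ `DeficientVanishing`

Child B of the `Consistency` split on route LeadingTerm (`LeadingTerm.DeficientVanishing`,
stmt-BirchSwinnertonDyer-23293: in a deficient cell `r_MW < r_an` the coefficient of `T^{r_MW}` of the
cyclotomic `p`-adic `L`-function vanishes) follows from crux C1 of route PadicCornerSqueeze
(`PadicCornerSqueeze.AnalyticRankLePadicOrder`, stmt-BirchSwinnertonDyer-19214: `r_an ≤ ord_T L_p` at every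
odd good ordinary prime): `r_MW < r_an ≤ ord_T L_p`, and a coefficient below the order is zero.
The converse fails (B asks for ONE vanishing coefficient beyond `r_MW`, C1 for `r_an − r_MW` of them), so B is
the weaker statement; both have the same open core (matched-parity cells with `r_MW ≥ 2`, first `(2,4)`).
Strategist record: `Cruxes/Consistency/STRATEGY-CENSUS-r1g2.md`, Decomposition 2 / Recommendation 3.
-/

namespace Summit.BirchSwinnertonDyer.BirchSwinnertonDyer.Theorems

/-- **`AnalyticRankLePadicOrder → DeficientVanishing`** (cross-route edge; one wall, several names):
if `r_an(W) ≤ ord_T L_p(f, α)` at every odd good ordinary prime, then in every deficient cell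
`r_MW < r_an` the `T^{r_MW}`-coefficient of `L_p(f, α)` vanishes (`PowerSeries.coeff_of_lt_order`). [folklore] -/
theorem deficientVanishing_of_analyticRankLePadicOrder
    (hV : Summit.BirchSwinnertonDyer.BirchSwinnertonDyer.Theses.PadicCornerSqueeze.AnalyticRankLePadicOrder) :
    Summit.BirchSwinnertonDyer.BirchSwinnertonDyer.Theses.LeadingTerm.DeficientVanishing := by
  intro W _ _ p _ hp hord N _ f hf hlt
  have h2 : p ≠ 2 := by omega
  have hle := hV W p h2 hord f hf
  apply PowerSeries.coeff_of_lt_order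
  exact lt_of_lt_of_le (by exact_mod_cast hlt) hle

end Summit.BirchSwinnertonDyer.BirchSwinnertonDyer.Theorems
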